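import Literature.MathematicalPhysics.QuantumLattice.HubbardTTPrimeDiagHopTransportThermal
import HarnessLib

/-!
# `U`-direction and JOINT `(t', U)` transport rows at positive temperature (torus-limit thermal
# convention): the thermal double occupancy is antitone in `U`, BOX ⇒ WORD in `U`, and ONE anchor
# cap-class certificate words the whole `(t'-box) × (U-box) × (T ≤ T₀)` cell

Family `hubbard` (topic `MathematicalPhysics/QuantumLattice`). Companion of
`HubbardTTPrimeDiagHopTransportThermal` (the `t'` direction; this file repeats its §2–§6 for the
second linear coupling `U`, whose conjugate word is the double-occupancy density
`D(ω) = e_{Φ(0,0,1)}(ω) = Re ω(n_{0↑}n_{0↓})`, and then combines both directions), written for stage S2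
of the Hubbard material-oracle programme («robustness lemmas consumed by S2: monotonicity/Lipschitz of
certified words in (t′, U, μ) so a parameter BOX maps to a certified word», `T > 0` leg: the phase
map's cells are `T × (U/t, t′/t, n)` boxes). The `T = 0` `U`-rows are `HubbardTTPrimeUBoxWords`
(seat unc-1); the state class here is the torus-limit THERMAL convention
(`IsTorusLimitOfMixture` of the canonical sector Gibbs states, `TorusSectorGibbsMixture`).

* §1 `sectorHamiltonianTT'_eq_add_smul_U` (`H_L(t,s,U₂)|_sec = H_L(t,s,U₁)|_sec + (U₂ − U₁)·H_L(0,0,1)|_sec`);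
  the THERMAL DOUBLE-OCCUPANCY MEAN IS ANTITONE IN `U` at every `β > 0` (finite volume,
  `sectorGibbs_doccMean_anti_U`, Peierls–Bogoliubov both ways) and the free-energy bracket
  `β(U₂−U₁)⟨D⟩_{U₂} ≤ log Z_L(U₁) − log Z_L(U₂) ≤ β(U₂−U₁)⟨D⟩_{U₁}` (`log_partitionFn_sector_sub_mem_Icc_U`).
* §2 thermodynamic limit along common tori: `D(ω₂) ≤ D(ω₁)` for thermal torus limits at `U₁ ≤ U₂`
  (`IsTorusLimitOfMixture.meanEnergy_onSite_anti_of_sectorGibbs`) — the `T > 0` twin of the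
  ground-state `T`-monotonicity `IsTorusLimitOf.docc_le_and_oneBody_le_of_groundStates`.
* §3 BOX ⇒ WORD in `U` along ANY tori (compactness, `exists_isTorusLimitOfMixture_sectorGibbs`): a
  thermal docc CEILING word at `U₁` holds at every `U ≥ U₁`, a FLOOR word at `U₂` at every `U ≤ U₂`,
  both ENDPOINT words bracket `D` on the whole `U`-box
  (`…meanEnergy_onSite_le_of_forall_left_U…`, `…le_meanEnergy_onSite_of_forall_right_U…`,
  `…meanEnergy_onSite_mem_Icc_of_forall_endpoints_U…`).
* §4 JOINT THERMAL CAP TRANSPORT from an anchor `(s₀, U₀)` to a thermal torus limit at `(s, U)`: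
  `e_{Φ(t,s₀,U₀)}(ω) ≤ e(t,s₀,U₀,n) + 2H_b(n/2)/β + (s − s₀)(K₂(ω₀) − K₂(ω)) + (U − U₀)(D(ω₀) − D(ω))`
  (`…meanEnergy_anchor₂_le_of_groundState_of_sectorGibbs`), kinematic form
  `≤ e(t,s₀,U₀,n) + 2H_b(n/2)/β + (32/π²)|s − s₀| + (n/2 − max(0, n−1))·|U − U₀|`
  (`…meanEnergy_anchor₂_mem_Icc_kinematic_of_sectorGibbs`; the docc range `[max(0,n−1), n/2]` prices the
  `U`-leg), hence the CELL THEOREM `forall_sectorGibbsLimit_tPrime_U_box_of_forall_cap_kinematic`: a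
  property certified at the anchor for the thermal cap class (torus limits of probability mixtures of
  unit `rectN n L`-particle vectors with `e_{Φ(t,s₀,U₀)}(ω) ≤ u`) holds for EVERY thermal torus limit at
  EVERY `(s, U) ∈ [s₁,s₂] × [U₁,U₂]` (`U₁ ≥ 0`) and EVERY `β' ≥ β` once
  `u ≥ u₀ + 2H_b(n/2)/β + (32/π²)·max(s₂−s₀, s₀−s₁) + (n/2 − max(0,n−1))·max(U₂−U₀, U₀−U₁)`.

Everything is PROVED; no definition, no named fact, no number. HONEST SCOPE as in the companion:
thermal words do not move in `β`; no thermodynamic-limit free energy; finite-volume grand-canonical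
concavity is `GibbsFreeEnergyCouplingConcavity`. WHAT THIS IS NOT: no certificate, no phase sentence.

## Mathlib / tree search

REUSED: everything listed in `HubbardTTPrimeDiagHopTransportThermal` plus
`TTPrimeFree.hubbardTorusTT'_eq_add_smul` (`U` enters linearly, `HubbardTTPrimeFreeKineticBound`),
`InfVolFermionState.hubbardTorusTT'_zero_zero_one`, `IsTorusLimitOf.docc_nonneg/docc_le_half_density/density_sub_one_le_docc`
(`HubbardOneBodyKinematicRows` §4), `IsTorusLimitOfMixture.docc_mem_Icc_of_sectorGibbs`
(`TorusSectorGibbsMixture` §4), `re_gibbsState_sectorHamiltonianTT'_coupling`,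
`exists_isTorusLimitOfMixture_sectorGibbs`, `IsTorusLimitOfMixture.comp_tendsto`.
`lean search 'docc.*anti.*sectorGibbs|onSite.*sectorGibbs.*forall|anchor₂' --decl`: nothing.

## References

* E. H. Lieb, Commun. Math. Phys. 31 (1973) 327, §V (5.2)–(5.4). [cite: Lieb1973, §V (5.2)–(5.4)]
* D. Ruelle, *Statistical Mechanics: Rigorous Results* (1969), §2.5, §3.4. [cite: Ruelle1969, §2.5]
* R. B. Israel, *Convexity in the Theory of Lattice Gases* (1979), Lemma II.3.1. [cite: Israel1979, Lemma II.3.1]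
* T. Koma, H. Tasaki, J. Stat. Phys. 76 (1994) 745, §1 (`∂E/∂U = ⟨D⟩`, concavity in `U`).
  [cite: KomaTasaki1994, §1]
-/

noncomputable section

namespace Literature.MathematicalPhysics.QuantumLattice

open Matrix Finset HubbardWave0 Literature.Probability.LatticeModels ThermodynamicLimit
open _root_.Filter
open scoped _root_.Topology ComplexOrder BigOperators

/-! ### §1 Finite volume: affinity in `U`, the thermal docc mean is antitone in `U`, PB bracket -/

section Sector

variable {n : ℝ}

/-- The Peierls–Bogoliubov bracket (the tree's `log_partitionFn_sub_le_log_partitionFn_add` read at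
`H` and at `H + W`). [cite: Lieb1973, §V (5.2)–(5.4)] -/
private theorem pb_bracket_U {m : Type*} [Fintype m] [DecidableEq m] [Nonempty m] {H W : Matrix m m ℂ}
    (hH : H.IsHermitian) (hW : W.IsHermitian) (β : ℝ) :
    β * (gibbsState β (H + W) W).re ≤
        Real.log (partitionFn β H).re - Real.log (partitionFn β (H + W)).re ∧
      Real.log (partitionFn β H).re - Real.log (partitionFn β (H + W)).re ≤
        β * (gibbsState β H W).re := by
  have h1 := log_partitionFn_sub_le_log_partitionFn_add hH hW β
  have h2 := log_partitionFn_sub_le_log_partitionFn_add (hH.add hW) hW.neg β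
  rw [add_neg_cancel_right, map_neg, Complex.neg_re] at h2
  constructor <;> linarith

/-- A real multiple of a Hermitian matrix is Hermitian. [folklore] -/
private theorem isHermitian_ofReal_smul_sectorU {m : Type*} {K : Matrix m m ℂ} (hK : K.IsHermitian)
    (c : ℝ) : ((c : ℂ) • K).IsHermitian := by
  rw [Matrix.IsHermitian, Matrix.conjTranspose_smul, hK.eq, Complex.star_def, Complex.conj_ofReal]

/-- **The interaction enters the sector Hamiltonian linearly**:
`H_L(t,s,U₂)|_sec = H_L(t,s,U₁)|_sec + (U₂ − U₁)·H_L(0,0,1)|_sec`, `H_L(0,0,1) = Σ_x n_{x↑}n_{x↓}`.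
[cite: KomaTasaki1994, §1] -/
theorem sectorHamiltonianTT'_eq_add_smul_U (L : ℕ) [NeZero L] (t s U₁ U₂ n : ℝ) :
    sectorHamiltonianTT' t s U₂ n L =
      sectorHamiltonianTT' t s U₁ n L + ((U₂ - U₁ : ℝ) : ℂ) • sectorHamiltonianTT' 0 0 1 n L := by
  unfold sectorHamiltonianTT'
  rw [TTPrimeFree.hubbardTorusTT'_eq_add_smul t s U₁ U₂, InfVolFermionState.hubbardTorusTT'_zero_zero_one]
  ext a b
  simp only [submatrix_apply, Matrix.add_apply, Matrix.smul_apply, smul_eq_mul]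

/-- **The thermal double-occupancy mean of the canonical sector Gibbs state is antitone in `U`**
(finite volume, `β > 0`): for `U₁ ≤ U₂`,
`Σ_i p_{L,i}(U₂) Re⟨ψ_{L,i}(U₂), H_L(0,0,1) ψ_{L,i}(U₂)⟩ ≤ Σ_i p_{L,i}(U₁) Re⟨ψ_{L,i}(U₁), H_L(0,0,1) ψ_{L,i}(U₁)⟩`
(Peierls–Bogoliubov both ways for the concave free energy `U ↦ −β⁻¹ log Z_{L,β}(t,s,U)`).
[cite: Lieb1973, §V (5.2)–(5.4)] [cite: KomaTasaki1994, §1] -/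
theorem sectorGibbs_doccMean_anti_U (hn0 : 0 ≤ n) (hn2 : n ≤ 2) (L : ℕ) [NeZero L]
    (t s : ℝ) {β : ℝ} (hβ : 0 < β) {U₁ U₂ : ℝ} (hU : U₁ ≤ U₂) :
    ∑ i, sectorGibbsWeightTT' β t s U₂ n L i *
        (expect (hubbardTorusTT' L 0 0 1) (sectorGibbsVectorTT' t s U₂ n L i)).re ≤
      ∑ i, sectorGibbsWeightTT' β t s U₁ n L i *
        (expect (hubbardTorusTT' L 0 0 1) (sectorGibbsVectorTT' t s U₁ n L i)).re := by
  haveI := nonempty_szConfig hn0 hn2 L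
  rcases hU.eq_or_lt with h | hlt
  · subst h; exact le_rfl
  have hd : 0 < U₂ - U₁ := sub_pos.2 hlt
  have hHh : (sectorHamiltonianTT' t s U₁ n L).IsHermitian := isHermitian_sectorHamiltonianTT' t s U₁ n L
  have hKh : (sectorHamiltonianTT' 0 0 1 n L).IsHermitian := isHermitian_sectorHamiltonianTT' 0 0 1 n L
  have hWh : (((U₂ - U₁ : ℝ) : ℂ) • sectorHamiltonianTT' 0 0 1 n L).IsHermitian :=
    isHermitian_ofReal_smul_sectorU hKh _
  have hHW := sectorHamiltonianTT'_eq_add_smul_U L t s U₁ U₂ n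
  have hb := pb_bracket_U hHh hWh β
  rw [← hHW] at hb
  have hle : β * (gibbsState β (sectorHamiltonianTT' t s U₂ n L)
      (((U₂ - U₁ : ℝ) : ℂ) • sectorHamiltonianTT' 0 0 1 n L)).re ≤
      β * (gibbsState β (sectorHamiltonianTT' t s U₁ n L)
        (((U₂ - U₁ : ℝ) : ℂ) • sectorHamiltonianTT' 0 0 1 n L)).re := hb.1.trans hb.2
  have hle' := le_of_mul_le_mul_left hle hβ
  rw [map_smul, map_smul, smul_eq_mul, smul_eq_mul, Complex.re_ofReal_mul, Complex.re_ofReal_mul] at hle'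
  have hle'' := le_of_mul_le_mul_left hle' hd
  rwa [re_gibbsState_sectorHamiltonianTT'_coupling, re_gibbsState_sectorHamiltonianTT'_coupling] at hle''

/-- **Peierls–Bogoliubov bracket on the sector free-energy increment along `U`** (finite volume,
every real `β`): `β(U₂−U₁)⟨D⟩_{L,U₂} ≤ log Z_L(t,s,U₁) − log Z_L(t,s,U₂) ≤ β(U₂−U₁)⟨D⟩_{L,U₁}`, the
thermal means taken in mixture form. [cite: Lieb1973, §V (5.2)–(5.4)] -/
theorem log_partitionFn_sector_sub_mem_Icc_U (hn0 : 0 ≤ n) (hn2 : n ≤ 2) (L : ℕ) [NeZero L]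
    (t s β U₁ U₂ : ℝ) :
    Real.log (partitionFn β (sectorHamiltonianTT' t s U₁ n L)).re -
        Real.log (partitionFn β (sectorHamiltonianTT' t s U₂ n L)).re ∈
      Set.Icc
        (β * ((U₂ - U₁) * ∑ i, sectorGibbsWeightTT' β t s U₂ n L i *
          (expect (hubbardTorusTT' L 0 0 1) (sectorGibbsVectorTT' t s U₂ n L i)).re))
        (β * ((U₂ - U₁) * ∑ i, sectorGibbsWeightTT' β t s U₁ n L i *
          (expect (hubbardTorusTT' L 0 0 1) (sectorGibbsVectorTT' t s U₁ n L i)).re)) := by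
  haveI := nonempty_szConfig hn0 hn2 L
  have hHh : (sectorHamiltonianTT' t s U₁ n L).IsHermitian := isHermitian_sectorHamiltonianTT' t s U₁ n L
  have hKh : (sectorHamiltonianTT' 0 0 1 n L).IsHermitian := isHermitian_sectorHamiltonianTT' 0 0 1 n L
  have hWh : (((U₂ - U₁ : ℝ) : ℂ) • sectorHamiltonianTT' 0 0 1 n L).IsHermitian :=
    isHermitian_ofReal_smul_sectorU hKh _
  have hHW := sectorHamiltonianTT'_eq_add_smul_U L t s U₁ U₂ n
  have hb := pb_bracket_U hHh hWh β
  rw [← hHW, map_smul, map_smul, smul_eq_mul, smul_eq_mul, Complex.re_ofReal_mul, Complex.re_ofReal_mul,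
    re_gibbsState_sectorHamiltonianTT'_coupling, re_gibbsState_sectorHamiltonianTT'_coupling] at hb
  exact hb

end Sector

/-! ### §2 Thermodynamic limit along common tori: the thermal `D` is antitone in `U` -/

namespace InfVolFermionState

variable {t s n β : ℝ}

/-- **The thermal double-occupancy density is antitone in `U` along a common sequence of tori**:
torus limits `ω₁`, `ω₂` of the canonical sector Gibbs states of `H(t,s,U₁)`, `H(t,s,U₂)` at the same
`β > 0`, `n` and `Ls → ∞` with `U₁ ≤ U₂` satisfy `D(ω₂) ≤ D(ω₁)`, `D(ω) = e_{Φ(0,0,1)}(ω)`.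
[cite: KomaTasaki1994, §1] [cite: Lieb1973, §V (5.2)–(5.4)] -/
theorem IsTorusLimitOfMixture.meanEnergy_onSite_anti_of_sectorGibbs
    (hn0 : 0 ≤ n) (hn2 : n ≤ 2) (hβ : 0 < β) {U₁ U₂ : ℝ} (hU : U₁ ≤ U₂)
    {ω₁ ω₂ : InfVolFermionState 2} {Ls : ℕ → ℕ}
    (h₁ : ω₁.IsTorusLimitOfMixture (sectorGibbsCount n) (fun L => sectorGibbsWeightTT' β t s U₁ n L)
      (fun L => sectorGibbsVectorTT' t s U₁ n L) Ls)
    (h₂ : ω₂.IsTorusLimitOfMixture (sectorGibbsCount n) (fun L => sectorGibbsWeightTT' β t s U₂ n L)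
      (fun L => sectorGibbsVectorTT' t s U₂ n L) Ls)
    (hLs : Tendsto Ls atTop atTop) :
    ω₂.meanEnergy (hubbardTTPrimeFermionInteraction 0 0 1) 1 ≤
      ω₁.meanEnergy (hubbardTTPrimeFermionInteraction 0 0 1) 1 := by
  refine le_of_tendsto_of_tendsto (h₂.tendsto_meanEnergy_hubbardTTPrime 0 0 1 hLs)
    (h₁.tendsto_meanEnergy_hubbardTTPrime 0 0 1 hLs) ?_
  filter_upwards [hLs.eventually_ge_atTop 1] with j hj
  haveI : NeZero (Ls j) := ⟨by omega⟩
  have hL2 : (0 : ℝ) < (Ls j : ℝ) ^ 2 := by positivity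
  have hmono := sectorGibbs_doccMean_anti_U hn0 hn2 (Ls j) t s hβ hU
  have hsum : ∀ (b : ℝ), ∑ i, sectorGibbsWeightTT' β t s b n (Ls j) i *
      ((QuantumLattice.expect (hubbardTorusTT' (Ls j) 0 0 1) (sectorGibbsVectorTT' t s b n (Ls j) i)).re /
        (Ls j : ℝ) ^ 2) =
      (∑ i, sectorGibbsWeightTT' β t s b n (Ls j) i *
        (QuantumLattice.expect (hubbardTorusTT' (Ls j) 0 0 1) (sectorGibbsVectorTT' t s b n (Ls j) i)).re) /
        (Ls j : ℝ) ^ 2 := by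
    intro b
    rw [Finset.sum_div]
    exact Finset.sum_congr rfl fun i _ => by ring
  simp only [hsum]
  exact div_le_div_of_nonneg_right hmono hL2.le

/-! ### §3 BOX ⇒ WORD in `U` at `T > 0` along any tori -/

/-- **A thermal docc-CEILING word moves to larger `U`**: if `D(ω₁) ≤ A` for every torus limit of the
canonical sector Gibbs states of `H(t,s,U₁)` at `(β, n)`, then `D(ω) ≤ A` for every torus limit of the
canonical sector Gibbs states of `H(t,s,U)` at `(β, n)`, `U ≥ U₁`. [cite: KomaTasaki1994, §1] [cite: Lieb1973, §V (5.2)–(5.4)] -/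
theorem IsTorusLimitOfMixture.meanEnergy_onSite_le_of_forall_left_U_of_sectorGibbs
    (hn0 : 0 ≤ n) (hn2 : n ≤ 2) (hβ : 0 < β) {U₁ U : ℝ} (hU : U₁ ≤ U) {A : ℝ}
    (hA : ∀ (ω₁ : InfVolFermionState 2) (Ls₁ : ℕ → ℕ), Tendsto Ls₁ atTop atTop →
      ω₁.IsTorusLimitOfMixture (sectorGibbsCount n) (fun L => sectorGibbsWeightTT' β t s U₁ n L)
        (fun L => sectorGibbsVectorTT' t s U₁ n L) Ls₁ →
      ω₁.meanEnergy (hubbardTTPrimeFermionInteraction 0 0 1) 1 ≤ A)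
    {ω : InfVolFermionState 2} {Ls : ℕ → ℕ}
    (h : ω.IsTorusLimitOfMixture (sectorGibbsCount n) (fun L => sectorGibbsWeightTT' β t s U n L)
      (fun L => sectorGibbsVectorTT' t s U n L) Ls)
    (hLs : Tendsto Ls atTop atTop) :
    ω.meanEnergy (hubbardTTPrimeFermionInteraction 0 0 1) 1 ≤ A := by
  obtain ⟨φ, hφ, ω₁, h₁⟩ := exists_isTorusLimitOfMixture_sectorGibbs β t s U₁ hn0 hn2 hLs
  have hLφ : Tendsto (Ls ∘ φ) atTop atTop := hLs.comp hφ.tendsto_atTop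
  exact (h₁.meanEnergy_onSite_anti_of_sectorGibbs hn0 hn2 hβ hU (h.comp_tendsto hφ.tendsto_atTop)
    hLφ).trans (hA ω₁ (Ls ∘ φ) hLφ h₁)

/-- **A thermal docc-FLOOR word moves to smaller `U`**: `B ≤ D(ω₂)` for every thermal torus limit at
`U₂` gives `B ≤ D(ω)` for every thermal torus limit at `U ≤ U₂` (same `β, t, s, n`).
[cite: KomaTasaki1994, §1] [cite: Lieb1973, §V (5.2)–(5.4)] -/
theorem IsTorusLimitOfMixture.le_meanEnergy_onSite_of_forall_right_U_of_sectorGibbs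
    (hn0 : 0 ≤ n) (hn2 : n ≤ 2) (hβ : 0 < β) {U U₂ : ℝ} (hU : U ≤ U₂) {B : ℝ}
    (hB : ∀ (ω₂ : InfVolFermionState 2) (Ls₂ : ℕ → ℕ), Tendsto Ls₂ atTop atTop →
      ω₂.IsTorusLimitOfMixture (sectorGibbsCount n) (fun L => sectorGibbsWeightTT' β t s U₂ n L)
        (fun L => sectorGibbsVectorTT' t s U₂ n L) Ls₂ →
      B ≤ ω₂.meanEnergy (hubbardTTPrimeFermionInteraction 0 0 1) 1)
    {ω : InfVolFermionState 2} {Ls : ℕ → ℕ}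
    (h : ω.IsTorusLimitOfMixture (sectorGibbsCount n) (fun L => sectorGibbsWeightTT' β t s U n L)
      (fun L => sectorGibbsVectorTT' t s U n L) Ls)
    (hLs : Tendsto Ls atTop atTop) :
    B ≤ ω.meanEnergy (hubbardTTPrimeFermionInteraction 0 0 1) 1 := by
  obtain ⟨φ, hφ, ω₂, h₂⟩ := exists_isTorusLimitOfMixture_sectorGibbs β t s U₂ hn0 hn2 hLs
  have hLφ : Tendsto (Ls ∘ φ) atTop atTop := hLs.comp hφ.tendsto_atTop
  exact (hB ω₂ (Ls ∘ φ) hLφ h₂).trans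
    ((h.comp_tendsto hφ.tendsto_atTop).meanEnergy_onSite_anti_of_sectorGibbs hn0 hn2 hβ hU h₂ hLφ)

/-- **The two ENDPOINT docc words bracket the thermal `D` on the whole `U`-box**: a ceiling word `A`
at `U₁` and a floor word `B` at `U₂` give `B ≤ D(ω) ≤ A` for every thermal torus limit at every
`U ∈ [U₁, U₂]`. The `T > 0` twin of `IsTorusLimitOf.re_expect_docc_mem_Icc_of_mem_Icc_U`.
[cite: KomaTasaki1994, §1] [cite: Lieb1973, §V (5.2)–(5.4)] -/
theorem IsTorusLimitOfMixture.meanEnergy_onSite_mem_Icc_of_forall_endpoints_U_of_sectorGibbs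
    (hn0 : 0 ≤ n) (hn2 : n ≤ 2) (hβ : 0 < β) {U₁ U₂ U : ℝ} (hU : U ∈ Set.Icc U₁ U₂) {A B : ℝ}
    (hA : ∀ (ω₁ : InfVolFermionState 2) (Ls₁ : ℕ → ℕ), Tendsto Ls₁ atTop atTop →
      ω₁.IsTorusLimitOfMixture (sectorGibbsCount n) (fun L => sectorGibbsWeightTT' β t s U₁ n L)
        (fun L => sectorGibbsVectorTT' t s U₁ n L) Ls₁ →
      ω₁.meanEnergy (hubbardTTPrimeFermionInteraction 0 0 1) 1 ≤ A)
    (hB : ∀ (ω₂ : InfVolFermionState 2) (Ls₂ : ℕ → ℕ), Tendsto Ls₂ atTop atTop →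
      ω₂.IsTorusLimitOfMixture (sectorGibbsCount n) (fun L => sectorGibbsWeightTT' β t s U₂ n L)
        (fun L => sectorGibbsVectorTT' t s U₂ n L) Ls₂ →
      B ≤ ω₂.meanEnergy (hubbardTTPrimeFermionInteraction 0 0 1) 1)
    {ω : InfVolFermionState 2} {Ls : ℕ → ℕ}
    (h : ω.IsTorusLimitOfMixture (sectorGibbsCount n) (fun L => sectorGibbsWeightTT' β t s U n L)
      (fun L => sectorGibbsVectorTT' t s U n L) Ls)
    (hLs : Tendsto Ls atTop atTop) :
    ω.meanEnergy (hubbardTTPrimeFermionInteraction 0 0 1) 1 ∈ Set.Icc B A :=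
  ⟨h.le_meanEnergy_onSite_of_forall_right_U_of_sectorGibbs hn0 hn2 hβ hU.2 hB hLs,
    h.meanEnergy_onSite_le_of_forall_left_U_of_sectorGibbs hn0 hn2 hβ hU.1 hA hLs⟩

/-! ### §4 JOINT `(t', U)` thermal cap transport and the cell theorem -/

/-- **Joint thermal anchor cap, two-state form.** For a thermal torus limit `ω` at `(β, t, s, U, n)`
(`β > 0`, `U ≥ 0`, `0 ≤ n < 2`) and a torus-limit ground state `ω₀` at the ANCHOR `(s₀, U₀)`, `U₀ ≥ 0`:
`e_{Φ(t,s₀,U₀)}(ω) ≤ e(t,s₀,U₀,n) + 2H_b(n/2)/β + (s − s₀)(K₂(ω₀) − K₂(ω)) + (U − U₀)(D(ω₀) − D(ω))`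
(affinity in both couplings, entropy cap at `(s, U)`, joint supergradient inequality at the anchor).
[cite: Israel1979, Lemma II.3.1] [cite: KomaTasaki1994, §1] -/
theorem IsTorusLimitOfMixture.meanEnergy_anchor₂_le_of_groundState_of_sectorGibbs (t s₀ s : ℝ)
    {U₀ U : ℝ} (hU₀ : 0 ≤ U₀) (hU : 0 ≤ U) {n : ℝ} (hn0 : 0 ≤ n) (hn2 : n < 2) {β : ℝ} (hβ : 0 < β)
    {ω : InfVolFermionState 2} {Ls : ℕ → ℕ}
    (h : ω.IsTorusLimitOfMixture (sectorGibbsCount n) (fun L => sectorGibbsWeightTT' β t s U n L)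
      (fun L => sectorGibbsVectorTT' t s U n L) Ls) (hLs : Tendsto Ls atTop atTop)
    {ω₀ : InfVolFermionState 2} {ψ₀ : ∀ L, Fock (Orb (FermionTorus 2 L))} {Ls₀ : ℕ → ℕ}
    (h₀ : ω₀.IsTorusLimitOf ψ₀ Ls₀) (hLs₀ : Tendsto Ls₀ atTop atTop)
    (hψ₀ : ∀ j, IsGroundStateInSector (hubbardTorusTT' (Ls₀ j) t s₀ U₀) (rectN n (Ls₀ j)) 0 (ψ₀ (Ls₀ j)))
    (h1₀ : ∀ j, star (ψ₀ (Ls₀ j)) ⬝ᵥ ψ₀ (Ls₀ j) = 1) :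
    ω.meanEnergy (hubbardTTPrimeFermionInteraction t s₀ U₀) 1 ≤
      energyDensityTT' t s₀ U₀ n + 2 * Real.binEntropy (n / 2) / β +
        (s - s₀) * (ω₀.meanEnergy (hubbardTTPrimeFermionInteraction 0 1 0) 1 -
          ω.meanEnergy (hubbardTTPrimeFermionInteraction 0 1 0) 1) +
        (U - U₀) * (ω₀.meanEnergy (hubbardTTPrimeFermionInteraction 0 0 1) 1 -
          ω.meanEnergy (hubbardTTPrimeFermionInteraction 0 0 1) 1) := by
  have haff := ω.meanEnergy_hubbardTTPrime_affine t s U s₀ U₀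
  have hcap := h.meanEnergy_hubbardTTPrime_le_energyDensityTT'_add_binEntropy_div t s hU hn0 hn2 hβ hLs
  have hsg := h₀.energyDensityTT'_le_affine t s₀ hU₀ hn0 hn2 hLs₀ hψ₀ h1₀ s hU
  rw [haff]
  have k1 : (U₀ - U) * ω.meanEnergy (hubbardTTPrimeFermionInteraction 0 0 1) 1 =
      -((U - U₀) * ω.meanEnergy (hubbardTTPrimeFermionInteraction 0 0 1) 1) := by ring
  have k2 : (s₀ - s) * ω.meanEnergy (hubbardTTPrimeFermionInteraction 0 1 0) 1 =
      -((s - s₀) * ω.meanEnergy (hubbardTTPrimeFermionInteraction 0 1 0) 1) := by ring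
  rw [k1, k2, mul_sub, mul_sub]
  linarith

/-- **Joint thermal anchor WINDOW, kinematic form**: every thermal torus limit `ω` at
`(β, t, s, U, n)` satisfies, for every anchor `(s₀, U₀)` with `U₀ ≥ 0`,
`e(t,s₀,U₀,n) ≤ e_{Φ(t,s₀,U₀)}(ω) ≤ e(t,s₀,U₀,n) + 2H_b(n/2)/β + (32/π²)|s − s₀| + (n/2 − max(0,n−1))·|U − U₀|`
(the `U`-leg is priced by the kinematic docc range `[max(0,n−1), n/2]` of both states).
[cite: Israel1979, Lemma II.3.1] [cite: KomaTasaki1994, §1] -/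
theorem IsTorusLimitOfMixture.meanEnergy_anchor₂_mem_Icc_kinematic_of_sectorGibbs (t s₀ s : ℝ)
    {U₀ U : ℝ} (hU₀ : 0 ≤ U₀) (hU : 0 ≤ U) {n : ℝ} (hn0 : 0 ≤ n) (hn2 : n < 2) {β : ℝ} (hβ : 0 < β)
    {ω : InfVolFermionState 2} {Ls : ℕ → ℕ}
    (h : ω.IsTorusLimitOfMixture (sectorGibbsCount n) (fun L => sectorGibbsWeightTT' β t s U n L)
      (fun L => sectorGibbsVectorTT' t s U n L) Ls) (hLs : Tendsto Ls atTop atTop) :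
    ω.meanEnergy (hubbardTTPrimeFermionInteraction t s₀ U₀) 1 ∈
      Set.Icc (energyDensityTT' t s₀ U₀ n)
        (energyDensityTT' t s₀ U₀ n + 2 * Real.binEntropy (n / 2) / β + 32 / Real.pi ^ 2 * |s - s₀| +
          (n / 2 - max 0 (n - 1)) * |U - U₀|) := by
  refine ⟨h.energyDensityTT'_le_meanEnergy_of_sectorGibbs t s U hn0 hn2 β hLs s₀ hU₀, ?_⟩
  obtain ⟨ψ₀, φ₀, ω₀, hφ₀, hψ₀, h1₀, h₀, -, -, -⟩ :=
    exists_isTorusLimitOf_sectorGroundState_TT' t s₀ U₀ hn0 hn2.le tendsto_id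
  have hL₀ : Tendsto (id ∘ φ₀) atTop atTop := tendsto_id.comp hφ₀.tendsto_atTop
  have hN₀ : ∀ j, IsNParticle (rectN n ((id ∘ φ₀) j)) (ψ₀ ((id ∘ φ₀) j)) := fun j =>
    ((mem_szSector_iff _ _ _).1 (hψ₀ _).1).1
  have hgs := h.meanEnergy_anchor₂_le_of_groundState_of_sectorGibbs t s₀ s hU₀ hU hn0 hn2 hβ hLs h₀
    hL₀ (fun j => hψ₀ _) (fun j => h1₀ _)
  -- kinematic rows: K₂ of both states in [-16/π², 16/π²], D of both in [max 0 (n-1), n/2]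
  have hK := h.abs_meanEnergy_diagHop_le_of_sectorGibbs t s U hn0 hn2 β hLs
  have hK₀ := h₀.abs_meanEnergy_diagHop_le hn0 hn2 hL₀ hN₀ (fun j => h1₀ _)
  have hD := h.docc_mem_Icc_of_sectorGibbs t s U hn0 hn2.le β hLs
  have hD₀lo : max 0 (n - 1) ≤ ω₀.meanEnergy (hubbardTTPrimeFermionInteraction 0 0 1) 1 :=
    max_le (h₀.docc_nonneg hL₀) (h₀.density_sub_one_le_docc hn0 hL₀ hN₀ (fun j => h1₀ _))
  have hD₀hi := h₀.docc_le_half_density hn0 hL₀ hN₀ (fun j => h1₀ _)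
  rw [abs_le] at hK hK₀
  have h3 : (s - s₀) * (ω₀.meanEnergy (hubbardTTPrimeFermionInteraction 0 1 0) 1 -
      ω.meanEnergy (hubbardTTPrimeFermionInteraction 0 1 0) 1) ≤ 32 / Real.pi ^ 2 * |s - s₀| := by
    have hdiff : |ω₀.meanEnergy (hubbardTTPrimeFermionInteraction 0 1 0) 1 -
        ω.meanEnergy (hubbardTTPrimeFermionInteraction 0 1 0) 1| ≤ 16 / Real.pi ^ 2 + 16 / Real.pi ^ 2 := by
      rw [abs_le]; constructor <;> linarith [hK.1, hK.2, hK₀.1, hK₀.2]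
    calc _ ≤ |(s - s₀) * (ω₀.meanEnergy (hubbardTTPrimeFermionInteraction 0 1 0) 1 -
          ω.meanEnergy (hubbardTTPrimeFermionInteraction 0 1 0) 1)| := le_abs_self _
      _ = |s - s₀| * |ω₀.meanEnergy (hubbardTTPrimeFermionInteraction 0 1 0) 1 -
          ω.meanEnergy (hubbardTTPrimeFermionInteraction 0 1 0) 1| := abs_mul _ _
      _ ≤ |s - s₀| * (16 / Real.pi ^ 2 + 16 / Real.pi ^ 2) := mul_le_mul_of_nonneg_left hdiff (abs_nonneg _)
      _ = 32 / Real.pi ^ 2 * |s - s₀| := by ring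
  have h4 : (U - U₀) * (ω₀.meanEnergy (hubbardTTPrimeFermionInteraction 0 0 1) 1 -
      ω.meanEnergy (hubbardTTPrimeFermionInteraction 0 0 1) 1) ≤ (n / 2 - max 0 (n - 1)) * |U - U₀| := by
    have hdiff : |ω₀.meanEnergy (hubbardTTPrimeFermionInteraction 0 0 1) 1 -
        ω.meanEnergy (hubbardTTPrimeFermionInteraction 0 0 1) 1| ≤ n / 2 - max 0 (n - 1) := by
      rw [abs_le]; constructor <;> linarith [hD.1, hD.2]
    calc _ ≤ |(U - U₀) * (ω₀.meanEnergy (hubbardTTPrimeFermionInteraction 0 0 1) 1 -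
          ω.meanEnergy (hubbardTTPrimeFermionInteraction 0 0 1) 1)| := le_abs_self _
      _ = |U - U₀| * |ω₀.meanEnergy (hubbardTTPrimeFermionInteraction 0 0 1) 1 -
          ω.meanEnergy (hubbardTTPrimeFermionInteraction 0 0 1) 1| := abs_mul _ _
      _ ≤ |U - U₀| * (n / 2 - max 0 (n - 1)) := mul_le_mul_of_nonneg_left hdiff (abs_nonneg _)
      _ = (n / 2 - max 0 (n - 1)) * |U - U₀| := mul_comm _ _
  linarith

/-- **BOX ⇒ WORD at `T > 0` on the JOINT `(t', U)` cell, kinematic form.** Suppose `P` has been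
certified AT THE ANCHOR `(t, s₀, U₀)` (`U₀ ≥ 0`) for the thermal cap class: every torus limit along
`Ls → ∞` of probability mixtures of unit `rectN n L`-particle vectors with `e_{Φ(t,s₀,U₀)}(ω) ≤ u`.
If `e(t,s₀,U₀,n) ≤ u₀` and
`u ≥ u₀ + 2H_b(n/2)/β + (32/π²)·max(s₂ − s₀, s₀ − s₁) + (n/2 − max(0,n−1))·max(U₂ − U₀, U₀ − U₁)`, then
`P ω` for EVERY thermal torus limit `ω` at EVERY `(s, U) ∈ [s₁,s₂] × [U₁,U₂]` (`U₁ ≥ 0`) and EVERY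
`β' ≥ β`: one anchor certificate words the `(t'-box) × (U-box) × (T ≤ 1/β)` cell.
[cite: Israel1979, Lemma II.3.1] [cite: KomaTasaki1994, §1] -/
theorem forall_sectorGibbsLimit_tPrime_U_box_of_forall_cap_kinematic (t : ℝ) {s₁ s₂ U₁ U₂ : ℝ}
    (s₀ : ℝ) {U₀ : ℝ} (hU₀ : 0 ≤ U₀) (hU₁ : 0 ≤ U₁) {n : ℝ} (hn0 : 0 ≤ n) (hn2 : n < 2)
    {β : ℝ} (hβ : 0 < β) {u₀ u : ℝ} (hu₀ : energyDensityTT' t s₀ U₀ n ≤ u₀)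
    (hu : u₀ + 2 * Real.binEntropy (n / 2) / β + 32 / Real.pi ^ 2 * max (s₂ - s₀) (s₀ - s₁) +
      (n / 2 - max 0 (n - 1)) * max (U₂ - U₀) (U₀ - U₁) ≤ u)
    {P : InfVolFermionState 2 → Prop}
    (hP : ∀ (ω : InfVolFermionState 2) (m : ℕ → ℕ) (p : ∀ L, Fin (m L) → ℝ)
      (ψ : ∀ L, Fin (m L) → Fock (Orb (FermionTorus 2 L))) (Ls : ℕ → ℕ),
      Tendsto Ls atTop atTop → (∀ L i, 0 ≤ p L i) → (∀ L, ∑ i, p L i = 1) →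
      (∀ L i, IsNParticle (rectN n L) (ψ L i)) → (∀ L i, star (ψ L i) ⬝ᵥ ψ L i = 1) →
      ω.IsTorusLimitOfMixture m p ψ Ls →
      ω.meanEnergy (hubbardTTPrimeFermionInteraction t s₀ U₀) 1 ≤ u → P ω)
    {s U : ℝ} (hs : s ∈ Set.Icc s₁ s₂) (hUm : U ∈ Set.Icc U₁ U₂) {β' : ℝ} (hβ' : β ≤ β')
    {ω : InfVolFermionState 2} {Ls : ℕ → ℕ}
    (h : ω.IsTorusLimitOfMixture (sectorGibbsCount n) (fun L => sectorGibbsWeightTT' β' t s U n L)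
      (fun L => sectorGibbsVectorTT' t s U n L) Ls) (hLs : Tendsto Ls atTop atTop) : P ω := by
  have hβ'0 : 0 < β' := hβ.trans_le hβ'
  have hU : 0 ≤ U := hU₁.trans hUm.1
  refine hP ω (sectorGibbsCount n) _ _ Ls hLs
    (fun L i => sectorGibbsWeightTT'_nonneg β' t s U n L i)
    (fun L => sum_sectorGibbsWeightTT' β' t s U hn0 hn2.le L)
    (fun L i => isNParticle_sectorGibbsVectorTT' t s U n L i)
    (fun L i => star_sectorGibbsVectorTT'_dotProduct_self t s U n L i) h ?_
  have hwin := (h.meanEnergy_anchor₂_mem_Icc_kinematic_of_sectorGibbs t s₀ s hU₀ hU hn0 hn2 hβ'0 hLs).2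
  have hH : 0 ≤ 2 * Real.binEntropy (n / 2) :=
    mul_nonneg zero_le_two (Real.binEntropy_nonneg (by linarith) (by linarith))
  have hent : 2 * Real.binEntropy (n / 2) / β' ≤ 2 * Real.binEntropy (n / 2) / β :=
    div_le_div_of_nonneg_left hH hβ hβ'
  have hmax : |s - s₀| ≤ max (s₂ - s₀) (s₀ - s₁) := by
    rcases le_total s₀ s with h0s | hs0
    · rw [abs_of_nonneg (sub_nonneg.2 h0s)]
      exact (sub_le_sub_right hs.2 _).trans (le_max_left _ _)
    · rw [abs_of_nonpos (sub_nonpos.2 hs0), neg_sub]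
      exact (sub_le_sub_left hs.1 _).trans (le_max_right _ _)
  have hmaxU : |U - U₀| ≤ max (U₂ - U₀) (U₀ - U₁) := by
    rcases le_total U₀ U with h0U | hU0
    · rw [abs_of_nonneg (sub_nonneg.2 h0U)]
      exact (sub_le_sub_right hUm.2 _).trans (le_max_left _ _)
    · rw [abs_of_nonpos (sub_nonpos.2 hU0), neg_sub]
      exact (sub_le_sub_left hUm.1 _).trans (le_max_right _ _)
  have hπ : 0 ≤ 32 / Real.pi ^ 2 := by positivity
  have hw : 0 ≤ n / 2 - max 0 (n - 1) := by
    rw [sub_nonneg, max_le_iff]; constructor <;> linarith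
  nlinarith [mul_le_mul_of_nonneg_left hmax hπ, mul_le_mul_of_nonneg_left hmaxU hw]

end InfVolFermionState

end Literature.MathematicalPhysics.QuantumLattice

end
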